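import Mathlib
import HarnessLib
import Literature.Analysis.FluidPDE.BeltramiFlows
import Summits.NavierStokesRegularity.FluidComputer.ABCStagnationSkeleton
import Summits.NavierStokesRegularity.FluidComputer.ABCStagnationJacobian

/-!
# The rank-one form of `∇U` at EVERY stagnation point of the ABC 1:1:1 host:
# `∇U = s·(√2/2)·(w wᵀ − I)`, `w ∈ {±1}³` the line direction, `s = sign det ∇U`
# (instab lane, door O-acc = O7 / obstruction P3 — companion of `ABCStagnationJacobian` (p436556); cell `ns-blowup`,
# seat `ns-blowup-instab2`)

HONEST FRAMING (human ruling D-0035): nothing here is a claim about Navier–Stokes. WHAT THIS IS NOT: not dynamics —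
`3 × 3` algebra on `J = Literature.Analysis.FluidPDE.ABC.jac 1 1 1 x` at the zeros of `U = abc 1 1 1`.

`ABCAlphaPointStrain` (p407903) proved BY EVALUATION that at the diagonal α-point `∇U(α₀) = (√2/2)(𝟙𝟙ᵀ − I)` — pure
axisymmetric strain, `𝟙` expanding at `√2`, the normal plane contracting ISOTROPICALLY at `√2/2` — and
`ABCStagnationJacobian` (p436556) proved from the stagnation equations that every zero has the characteristic
polynomial of such a matrix. This file closes the gap with the MATRIX IDENTITY itself, uniformly over all eight
zeros: with `cᵢ = cos xᵢ`, `w := (1, 2c₁c₂, 2c₀c₁)` (entries `±1`, `|w|² = 3` — the direction of the skeleton line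
through the point) and `s := 2√2·c₀c₁c₂` (`= +1` at type α, `−1` at type β, `= √2·det ∇U`),
`∇U = s·(√2/2)·(w wᵀ − I)`. Consequences: `∇U·w = s√2·w` and `∇U·v = −s(√2/2)·v` for EVERY `v ⊥ w` — at each α the
normal plane is contracted isotropically at `σ_α/2`, at each β expanded isotropically (the sheet-forming ends), which
is the exact local picture the heredity lemmas (`BurgersTubeHeredity`, `BurgersColumnarFlowMap`) and the site
detector's core/co-sign tests presuppose at a pinning site.

## What is proved (Mathlib + `BeltramiFlows` + `ABCStagnationSkeleton` + `ABCStagnationJacobian`; no definitions)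
`w_sq_eq_one` (the entries of `w` square to `1`), `w_norm_sq` (`|w|² = 3`), `s_sq_eq_one` (`s² = 1`),
`s_eq_sqrt_two_mul_det` (`s = √2·det ∇U`), `s_eq_one_iff` (`s = 1 ⇔ det ∇U = √2/2`: type α),
**`jac_eq_rankOne_of_abc_eq_zero`** (`Jⱼᵢ = s(√2/2)(wⱼwᵢ − δⱼᵢ)` entrywise), `mulVec_w` (`Σⱼ wⱼ Jⱼᵢ = s√2·wᵢ`),
**`mulVec_perp`** (`Σⱼ vⱼ Jⱼᵢ = −s(√2/2)·vᵢ` whenever `v·w = 0`), and the typed corollaries `mulVec_perp_alpha`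
(`det = +√2/2`: normal plane contracts at `√2/2`) / `mulVec_perp_beta` (`det = −√2/2`: expands at `√2/2`),
`mulVec_w_alpha` / `mulVec_w_beta` (line rate `±√2`).
LABEL: MODEL-door kinematics. WHAT THIS IS NOT: not NS.
-/

namespace Summit.NavierStokesRegularity.FluidComputer.ABCStagnationStrainForm

open Real Literature.Analysis.FluidPDE ABCStagnationSkeleton ABCStagnationJacobian

/-- The entries of `w = (1, 2c₁c₂, 2c₀c₁)` square to one at a stagnation point (`cᵢ² = ½`). -/
theorem w_sq_eq_one {x : EuclideanSpace ℝ (Fin 3)} (h : ABC.abc 1 1 1 x = 0) :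
    (2 * (Real.cos (x 1) * Real.cos (x 2))) ^ 2 = 1 ∧ (2 * (Real.cos (x 0) * Real.cos (x 1))) ^ 2 = 1 := by
  have c0 := cos_sq_eq_half_of_abc_eq_zero h 0
  have c1 := cos_sq_eq_half_of_abc_eq_zero h 1
  have c2 := cos_sq_eq_half_of_abc_eq_zero h 2
  constructor
  · linear_combination (4 * Real.cos (x 2) ^ 2) * c1 + 2 * c2
  · linear_combination (4 * Real.cos (x 1) ^ 2) * c0 + 2 * c1

/-- `|w|² = 3`: `w/√3` is a unit vector along the skeleton line through the point. -/
theorem w_norm_sq {x : EuclideanSpace ℝ (Fin 3)} (h : ABC.abc 1 1 1 x = 0) :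
    (1:ℝ) ^ 2 + (2 * (Real.cos (x 1) * Real.cos (x 2))) ^ 2 + (2 * (Real.cos (x 0) * Real.cos (x 1))) ^ 2 = 3 := by
  obtain ⟨h1, h2⟩ := w_sq_eq_one h
  rw [h1, h2]; norm_num

/-- `s = 2√2·c₀c₁c₂` squares to one at a stagnation point. -/
theorem s_sq_eq_one {x : EuclideanSpace ℝ (Fin 3)} (h : ABC.abc 1 1 1 x = 0) :
    (2 * Real.sqrt 2 * (Real.cos (x 0) * Real.cos (x 1) * Real.cos (x 2))) ^ 2 = 1 := by
  have c0 := cos_sq_eq_half_of_abc_eq_zero h 0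
  have c1 := cos_sq_eq_half_of_abc_eq_zero h 1
  have c2 := cos_sq_eq_half_of_abc_eq_zero h 2
  have h2 : Real.sqrt 2 ^ 2 = 2 := Real.sq_sqrt (by norm_num)
  have e : (2 * Real.sqrt 2 * (Real.cos (x 0) * Real.cos (x 1) * Real.cos (x 2))) ^ 2 =
      4 * Real.sqrt 2 ^ 2 * (Real.cos (x 0) ^ 2 * Real.cos (x 1) ^ 2 * Real.cos (x 2) ^ 2) := by ring
  rw [e, h2, c0, c1, c2]; norm_num

/-- `s = √2·det ∇U` (`det ∇U = 2c₀c₁c₂` at a zero, `ABCStagnationJacobian.jac_det_eq_cos_of_abc_eq_zero`). -/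
theorem s_eq_sqrt_two_mul_det {x : EuclideanSpace ℝ (Fin 3)} (h : ABC.abc 1 1 1 x = 0) :
    2 * Real.sqrt 2 * (Real.cos (x 0) * Real.cos (x 1) * Real.cos (x 2)) =
      Real.sqrt 2 * (Matrix.of (ABC.jac 1 1 1 x)).det := by
  rw [jac_det_eq_cos_of_abc_eq_zero h]; ring

/-- TYPE α ⇔ `s = 1` (`det ∇U = +√2/2`); otherwise `s = −1` (`det ∇U = −√2/2`, type β). -/
theorem s_eq_one_iff {x : EuclideanSpace ℝ (Fin 3)} (h : ABC.abc 1 1 1 x = 0) :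
    2 * Real.sqrt 2 * (Real.cos (x 0) * Real.cos (x 1) * Real.cos (x 2)) = 1 ↔
      (Matrix.of (ABC.jac 1 1 1 x)).det = Real.sqrt 2 / 2 := by
  have h2 : Real.sqrt 2 ^ 2 = 2 := Real.sq_sqrt (by norm_num)
  have hs : 0 < Real.sqrt 2 := Real.sqrt_pos.2 (by norm_num)
  rw [s_eq_sqrt_two_mul_det h]
  constructor
  · intro hd
    have : Real.sqrt 2 * (Real.sqrt 2 * (Matrix.of (ABC.jac 1 1 1 x)).det) = Real.sqrt 2 * 1 := by rw [hd]
    have e : Real.sqrt 2 * (Real.sqrt 2 * (Matrix.of (ABC.jac 1 1 1 x)).det) =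
        2 * (Matrix.of (ABC.jac 1 1 1 x)).det := by rw [← mul_assoc, ← sq, h2]
    rw [e, mul_one] at this
    linarith
  · intro hd
    rw [hd]
    linear_combination (1 / 2 : ℝ) * h2

/-- **THE RANK-ONE FORM**: at every stagnation point, entrywise,
`∇Uⱼᵢ = s·(√2/2)·(wⱼwᵢ − δⱼᵢ)` with `w = (1, 2c₁c₂, 2c₀c₁)`, `s = 2√2·c₀c₁c₂`. -/
theorem jac_eq_rankOne_of_abc_eq_zero {x : EuclideanSpace ℝ (Fin 3)} (h : ABC.abc 1 1 1 x = 0) (j i : Fin 3) :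
    ABC.jac 1 1 1 x j i = (2 * Real.sqrt 2 * (Real.cos (x 0) * Real.cos (x 1) * Real.cos (x 2))) * (Real.sqrt 2 / 2) *
      (![1, 2 * (Real.cos (x 1) * Real.cos (x 2)), 2 * (Real.cos (x 0) * Real.cos (x 1))] j *
        ![1, 2 * (Real.cos (x 1) * Real.cos (x 2)), 2 * (Real.cos (x 0) * Real.cos (x 1))] i -
        if j = i then 1 else 0) := by
  have c0 := cos_sq_eq_half_of_abc_eq_zero h 0
  have c1 := cos_sq_eq_half_of_abc_eq_zero h 1
  have c2 := cos_sq_eq_half_of_abc_eq_zero h 2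
  have h2 : Real.sqrt 2 ^ 2 = 2 := Real.sq_sqrt (by norm_num)
  rw [jac_eq_of_abc_eq_zero h]
  fin_cases j <;> fin_cases i <;> simp
  · linear_combination (-(2 * Real.cos (x 0) * Real.cos (x 1) ^ 2 * Real.cos (x 2) ^ 2)) * h2 -
      (4 * Real.cos (x 0) * Real.cos (x 2) ^ 2) * c1 - (2 * Real.cos (x 0)) * c2
  · linear_combination (-(2 * Real.cos (x 0) ^ 2 * Real.cos (x 1) ^ 2 * Real.cos (x 2))) * h2 -
      (4 * Real.cos (x 1) ^ 2 * Real.cos (x 2)) * c0 - (2 * Real.cos (x 2)) * c1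
  · linear_combination (-(2 * Real.cos (x 0) * Real.cos (x 1) ^ 2 * Real.cos (x 2) ^ 2)) * h2 -
      (4 * Real.cos (x 0) * Real.cos (x 2) ^ 2) * c1 - (2 * Real.cos (x 0)) * c2
  · exact Or.inr (by linear_combination (4 * Real.cos (x 2) ^ 2) * c1 + 2 * c2)
  · linear_combination (-(4 * Real.cos (x 0) ^ 2 * Real.cos (x 1) ^ 3 * Real.cos (x 2) ^ 2)) * h2 -
      (8 * Real.cos (x 1) ^ 3 * Real.cos (x 2) ^ 2) * c0 - (4 * Real.cos (x 1) ^ 3) * c2 - (2 * Real.cos (x 1)) * c1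
  · linear_combination (-(2 * Real.cos (x 0) ^ 2 * Real.cos (x 1) ^ 2 * Real.cos (x 2))) * h2 -
      (4 * Real.cos (x 1) ^ 2 * Real.cos (x 2)) * c0 - (2 * Real.cos (x 2)) * c1
  · linear_combination (-(4 * Real.cos (x 0) ^ 2 * Real.cos (x 1) ^ 3 * Real.cos (x 2) ^ 2)) * h2 -
      (8 * Real.cos (x 1) ^ 3 * Real.cos (x 2) ^ 2) * c0 - (4 * Real.cos (x 1) ^ 3) * c2 - (2 * Real.cos (x 1)) * c1
  · exact Or.inr (by linear_combination (4 * Real.cos (x 1) ^ 2) * c0 + 2 * c1)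

/-- THE LINE DIRECTION IS THE `s√2` EIGENVECTOR: `Σⱼ wⱼ ∂ⱼUᵢ = s√2·wᵢ` (`+√2` at α: the line leaves; `−√2` at β: the
line arrives). -/
theorem mulVec_w {x : EuclideanSpace ℝ (Fin 3)} (h : ABC.abc 1 1 1 x = 0) (i : Fin 3) :
    ∑ j : Fin 3, ![1, 2 * (Real.cos (x 1) * Real.cos (x 2)), 2 * (Real.cos (x 0) * Real.cos (x 1))] j *
        ABC.jac 1 1 1 x j i =
      (2 * Real.sqrt 2 * (Real.cos (x 0) * Real.cos (x 1) * Real.cos (x 2))) * Real.sqrt 2 *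
        ![1, 2 * (Real.cos (x 1) * Real.cos (x 2)), 2 * (Real.cos (x 0) * Real.cos (x 1))] i := by
  have hw := w_norm_sq h
  simp only [jac_eq_rankOne_of_abc_eq_zero h, Fin.sum_univ_three]
  fin_cases i <;> simp
  · linear_combination (2 * Real.sqrt 2 * (Real.cos (x 0) * Real.cos (x 1) * Real.cos (x 2)) *
      (Real.sqrt 2 / 2) * 1) * hw
  · linear_combination (2 * Real.sqrt 2 * (Real.cos (x 0) * Real.cos (x 1) * Real.cos (x 2)) *
      (Real.sqrt 2 / 2) * (2 * (Real.cos (x 1) * Real.cos (x 2)))) * hw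
  · linear_combination (2 * Real.sqrt 2 * (Real.cos (x 0) * Real.cos (x 1) * Real.cos (x 2)) *
      (Real.sqrt 2 / 2) * (2 * (Real.cos (x 0) * Real.cos (x 1)))) * hw

/-- **THE NORMAL PLANE IS ISOTROPIC**: every `v` with `v·w = 0` satisfies `Σⱼ vⱼ ∂ⱼUᵢ = −s(√2/2)·vᵢ` — the whole
plane normal to the skeleton line is an eigenplane with the single rate `−s·√2/2`. -/
theorem mulVec_perp {x : EuclideanSpace ℝ (Fin 3)} (h : ABC.abc 1 1 1 x = 0) (v : Fin 3 → ℝ)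
    (hv : v 0 * 1 + v 1 * (2 * (Real.cos (x 1) * Real.cos (x 2))) + v 2 * (2 * (Real.cos (x 0) * Real.cos (x 1))) = 0)
    (i : Fin 3) :
    ∑ j : Fin 3, v j * ABC.jac 1 1 1 x j i =
      -(2 * Real.sqrt 2 * (Real.cos (x 0) * Real.cos (x 1) * Real.cos (x 2))) * (Real.sqrt 2 / 2) * v i := by
  simp only [jac_eq_rankOne_of_abc_eq_zero h, Fin.sum_univ_three]
  fin_cases i <;> simp
  · linear_combination (2 * Real.sqrt 2 * (Real.cos (x 0) * Real.cos (x 1) * Real.cos (x 2)) *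
      (Real.sqrt 2 / 2) * 1) * hv
  · linear_combination (2 * Real.sqrt 2 * (Real.cos (x 0) * Real.cos (x 1) * Real.cos (x 2)) *
      (Real.sqrt 2 / 2) * (2 * (Real.cos (x 1) * Real.cos (x 2)))) * hv
  · linear_combination (2 * Real.sqrt 2 * (Real.cos (x 0) * Real.cos (x 1) * Real.cos (x 2)) *
      (Real.sqrt 2 / 2) * (2 * (Real.cos (x 0) * Real.cos (x 1)))) * hv

/-- TYPE α (`det ∇U = +√2/2`, so `s = 1`): the normal plane CONTRACTS isotropically at `σ_α/2 = √2/2` —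
`Σⱼ vⱼ ∂ⱼUᵢ = −(√2/2)vᵢ` for every `v ⊥ w`. This is `ABCAlphaPointStrain.gradU_alpha0_mulVec_transverse` at ALL FOUR
α-points: the exact axisymmetric Burgers strain `diag(σ_α, −σ_α/2, −σ_α/2)` about the rope-carrying line. -/
theorem mulVec_perp_alpha {x : EuclideanSpace ℝ (Fin 3)} (h : ABC.abc 1 1 1 x = 0)
    (hd : (Matrix.of (ABC.jac 1 1 1 x)).det = Real.sqrt 2 / 2) (v : Fin 3 → ℝ)
    (hv : v 0 * 1 + v 1 * (2 * (Real.cos (x 1) * Real.cos (x 2))) + v 2 * (2 * (Real.cos (x 0) * Real.cos (x 1))) = 0)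
    (i : Fin 3) :
    ∑ j : Fin 3, v j * ABC.jac 1 1 1 x j i = -(Real.sqrt 2 / 2) * v i := by
  have hs : 2 * Real.sqrt 2 * (Real.cos (x 0) * Real.cos (x 1) * Real.cos (x 2)) = 1 := (s_eq_one_iff h).2 hd
  rw [mulVec_perp h v hv i, hs]; ring

/-- TYPE β (`det ∇U = −√2/2`, so `s = −1`): the normal plane EXPANDS isotropically at `√2/2` —
`Σⱼ vⱼ ∂ⱼUᵢ = +(√2/2)vᵢ` for every `v ⊥ w` (the sheet-forming end of each line). -/
theorem mulVec_perp_beta {x : EuclideanSpace ℝ (Fin 3)} (h : ABC.abc 1 1 1 x = 0)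
    (hd : (Matrix.of (ABC.jac 1 1 1 x)).det = -(Real.sqrt 2 / 2)) (v : Fin 3 → ℝ)
    (hv : v 0 * 1 + v 1 * (2 * (Real.cos (x 1) * Real.cos (x 2))) + v 2 * (2 * (Real.cos (x 0) * Real.cos (x 1))) = 0)
    (i : Fin 3) :
    ∑ j : Fin 3, v j * ABC.jac 1 1 1 x j i = (Real.sqrt 2 / 2) * v i := by
  have h2 : Real.sqrt 2 ^ 2 = 2 := Real.sq_sqrt (by norm_num)
  have hs : 2 * Real.sqrt 2 * (Real.cos (x 0) * Real.cos (x 1) * Real.cos (x 2)) = -1 := by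
    rw [s_eq_sqrt_two_mul_det h, hd]
    linear_combination (-(1 / 2 : ℝ)) * h2
  rw [mulVec_perp h v hv i, hs]; ring

/-- And along the line at type β the rate is `−√2`: `Σⱼ wⱼ ∂ⱼUᵢ = −√2·wᵢ` (at type α: `+√2`, `mulVec_w` with `s = 1`). -/
theorem mulVec_w_beta {x : EuclideanSpace ℝ (Fin 3)} (h : ABC.abc 1 1 1 x = 0)
    (hd : (Matrix.of (ABC.jac 1 1 1 x)).det = -(Real.sqrt 2 / 2)) (i : Fin 3) :
    ∑ j : Fin 3, ![1, 2 * (Real.cos (x 1) * Real.cos (x 2)), 2 * (Real.cos (x 0) * Real.cos (x 1))] j *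
        ABC.jac 1 1 1 x j i =
      -Real.sqrt 2 * ![1, 2 * (Real.cos (x 1) * Real.cos (x 2)), 2 * (Real.cos (x 0) * Real.cos (x 1))] i := by
  have h2 : Real.sqrt 2 ^ 2 = 2 := Real.sq_sqrt (by norm_num)
  have hs : 2 * Real.sqrt 2 * (Real.cos (x 0) * Real.cos (x 1) * Real.cos (x 2)) = -1 := by
    rw [s_eq_sqrt_two_mul_det h, hd]
    linear_combination (-(1 / 2 : ℝ)) * h2
  rw [mulVec_w h i, hs]; ring

/-- … and at type α it is `+√2`: `Σⱼ wⱼ ∂ⱼUᵢ = √2·wᵢ`. -/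
theorem mulVec_w_alpha {x : EuclideanSpace ℝ (Fin 3)} (h : ABC.abc 1 1 1 x = 0)
    (hd : (Matrix.of (ABC.jac 1 1 1 x)).det = Real.sqrt 2 / 2) (i : Fin 3) :
    ∑ j : Fin 3, ![1, 2 * (Real.cos (x 1) * Real.cos (x 2)), 2 * (Real.cos (x 0) * Real.cos (x 1))] j *
        ABC.jac 1 1 1 x j i =
      Real.sqrt 2 * ![1, 2 * (Real.cos (x 1) * Real.cos (x 2)), 2 * (Real.cos (x 0) * Real.cos (x 1))] i := by
  have hs : 2 * Real.sqrt 2 * (Real.cos (x 0) * Real.cos (x 1) * Real.cos (x 2)) = 1 := (s_eq_one_iff h).2 hd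
  rw [mulVec_w h i, hs]; ring

end Summit.NavierStokesRegularity.FluidComputer.ABCStagnationStrainForm
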